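/-
Copyright (c) 2026 the pub-hodgecm-mathlib formalisation cell (harness21).  Prover seat hodgecm-mathlib-K2Liu-p12 (g6), Track B «K2-LIT»,
#184♮ = hLiu418 = `stmt-HodgeConjecture-24832`; #42S block D, row D-2 ((σ-A) road desk K2Liu-p25 (g3) WORD #13: brick (D-cls) «THE PAYER OF `hclass′`»).
THEOREMS ONLY (no `def`, no `instance`, no `notation`, no named-fact hypothesis, no `sorry`, default heartbeats).
-/
import Summits.HodgeConjecture.HodgeConjecture.Theorems.K2LiuLocalSWSeamOfRecord              -- ★ p864360 [A4-close]: the `hclass′` binder bytes, `algebraMap_cmQuadraticGenerator_ne_zero`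
import Summits.HodgeConjecture.HodgeConjecture.Theorems.K2LiuIncoherentRankOneBadPlaceLineModel -- ★ p863939: the one-liner `hilbertSymbol_eq_neg_one_of_dead`
import HarnessLib

/-!
# Crux `HLiu418`, socket #42S block D, row D-2, brick (D-cls) `K2LiuIncoherentRankOneBadPlaceClassLetter`:
# THE CLASS LETTER `hclass′` OF THE CONE SOCKET ★ `K2LiuLocalSWSeamOfRecord.hV_faces_of_coneWord` FROM THE FAMILY INVARIANT AND THE NORM CONGRUENCE

Cell `hodgecm-mathlib`, crux item hLiu418 = `stmt-HodgeConjecture-24832`; squad K2 ∕ K2Liu, road `K2_Liu`, socket #42S, block D row D-2; (σ-A) road desk K2Liu-p25 (g3)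
WORD #13 (deal «(D-cls)»).  Lane `--supports stmt-HodgeConjecture-24832 --as helper` (count-neutral helper; closes no socket by itself).

WHY.  ★ p864360 [A4-close] `hV_faces_of_coneWord` (the D-2 socket OF RECORD on the ball road) takes BY VALUE the class letter
`hclass′ : ∀ X (rank one) j h, ∀ v ∈ Tf X j h, dead → hilbertSymbol L⁺_v (−(σc X v · (a X j h v)⁻¹)) (algebraMap θ) = −1` (`dead := ¬((val X, θ)_v = −1 ↔ v ∈ S₁)`,
`σc X v` the local corner scalar of the ball currency `hVdef′`, `a X j h v` the Gram determinant class of the family's hermitian space at `v`, `θ = cmQuadraticGenerator L`).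
THIS FILE pays it from the two CONSTRUCTOR letters of the (o1) END assembly and nothing else:
* (hfam) the FAMILY INVARIANT — the pattern `S₁` of the incoherent collection IS the set of bad places where the class scalar is the non-norm class:
  `∀ X (rank one) j h, ∀ v ∈ Tf X j h, (hilbertSymbol L⁺_v (−(a X j h v)) (algebraMap θ) = −1 ↔ v ∈ S₁)` (for `V′_v = V₁ ⊕ H`: `−det V′_v ≡ a_{V₁,v}` modulo local
  norms, ★ p864360 §5 `hilbertSymbol_neg_mul_inv_det_eq`, so this is the LINE collection's defining pattern `(a_{V₁,v}, θ)_v = −1 ↔ v ∈ S₁`);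
* (hnorm) the NORM CONGRUENCE between the constructor's global value `val X ∈ L⁺` and the local corner scalar: `σc X v = ι_v(val X) · (r² − θ·s²)` with `r² − θ·s² ≠ 0`
  (a local norm from `L_w = L⁺_v(√θ)`) — it holds with `(r, s) := (1, 0)` when the constructor pins `val` by `ι_v(val X) = σc X v`; it is the ONE consistency condition
  between the dead-place dispatch (★ `K2LiuIncoherentRankOneDeadPlaces`, which reads `(val X, θ)_v`) and the cone word (which reads `σc X v`).
HEADS.  **`hclass'_of_dead`** — (hfam) + (hnorm) + the non-vanishing letters `hval` (★ p863475's bytes), `ha` ⟹ `hclass′` in ★ p864360's binder BYTES, by ★ p863939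
`hilbertSymbol_eq_neg_one_of_dead` at `x := ι_v(val X)`, `a₀ := −a X j h v`, `P := (v ∈ S₁)`, `u := −(σc X v · (a X j h v)⁻¹)` (`(−a)⁻¹ = −a⁻¹`); and the LINE-currency
twin **`hclass'_of_dead_of_line`** — (hline) `(a₁ X j h v, θ)_v = −1 ↔ v ∈ S₁` for the complementary line's scalar `a₁` + a square-class bridge letter
`hbridge : (−(β·a⁻¹), θ)_v = (β·a₁⁻¹, θ)_v` (★ p864360 §5 `hilbertSymbol_neg_mul_inv_det_eq` at a non-split `v`) ⟹ the same `hclass′`.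
[cite: Omeara1963, §63B (63:10, 63:13a)] [cite: KudlaRallis1994, §2 (2.10)–(2.12)] [cite: Kudla1997, §2]
HONEST LABEL.  Count-neutral helper; it retires nothing by itself: `HC_CM` is proved only modulo the 7 printed citations (2 remaining named inputs:
hLiu418 = `stmt-HodgeConjecture-24832`, h413 = `stmt-HodgeConjecture-24833`) until rung 0 closes; (hfam)∕(hnorm) are constructor-definitional letters of the END assembly.

## References
* [Omeara1963] O. T. O'Meara, *Introduction to Quadratic Forms* (1963), §63B (63:10), (63:13a) (Hilbert symbol: bimultiplicativity, norms, square classes).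
* [KudlaRallis1994] S. Kudla, S. Rallis, *A regularized Siegel–Weil formula: the first term identity*, Ann. of Math. 140 (1994), §2 (2.10)–(2.12).
* [Kudla1997] S. Kudla, *Central derivatives of Eisenstein series and height pairings*, Ann. of Math. 146 (1997), §2 (incoherent collections, the local dichotomy).
-/

set_option autoImplicit false
set_option linter.dupNamespace false -- the mandated namespace repeats `HodgeConjecture.HodgeConjecture`

noncomputable section

open scoped Matrix
open NumberField IsDedekindDomain Matrix
open Literature.NumberTheory.QuadraticForms Literature.NumberTheory.Automorphic Literature.NumberTheory.Automorphic.UnitaryGroup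
open Literature.NumberTheory.GaloisRepresentations Literature.NumberTheory.GaloisRepresentations.IsNonarchimedeanLocalField
open Literature.NumberTheory.GelbartRogawski1991 Literature.NumberTheory.GelbartRogawski1991.GRConstruction
open Summit.HodgeConjecture.HodgeConjecture.Cruxes.HLiu418

namespace Summit.HodgeConjecture.HodgeConjecture.Cruxes.HLiu418.K2LiuIncoherentRankOneBadPlaceClassLetter

open K2LiuSiegelUnipotentFourierDefs

variable (L : Type) [Field L] [NumberField L] [IsCMField L]
variable {N M n : ℕ} (e : Fin N × Fin M ≃ Fin n)
  (dV : Fin N → L) (hdV : ∀ i, IsCMField.complexConj L (dV i) = dV i)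
  (dW : Fin M → L) (hdW : ∀ i, IsCMField.complexConj L (dW i) = dW i)

variable {ι : skewMatrices ((IsCMField.complexConj L : L ≃ₐ[Fp L] L) : L →+* L) ((gramR L e dV hdV dW hdW).map (algebraMap (Fp L) L)) → Type}

/-- **(D-cls) THE CLASS LETTER OF THE CONE SOCKET FROM THE FAMILY INVARIANT AND THE NORM CONGRUENCE.**  Frame: the pattern `S₁`, the constructor's value `val`
(`hval`: non-zero on rank one, ★ p863475's bytes), the bad finite places `Tf X j h`, the local corner scalars `σc X v` and the class scalars `a X j h v ≠ 0` of ★ p864360.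
Letters: (hfam) `(−a X j h v, θ)_v = −1 ↔ v ∈ S₁` on `Tf`; (hnorm) `σc X v = ι_v(val X)·(r² − θ s²)`, `r² − θ s² ≠ 0`.  Conclusion = ★ p864360 `hV_faces_of_coneWord`'s
`hclass′` binder VERBATIM: at a DEAD bad place (`¬((val X, θ)_v = −1 ↔ v ∈ S₁)`) the corner-over-class scalar `−σc X v·(a X j h v)⁻¹` has symbol `−1` — ★ p863939
`hilbertSymbol_eq_neg_one_of_dead` (`x := ι_v(val X)`, `a₀ := −a`, `u := −(σc·a⁻¹) = x·(−a)⁻¹·(r² − θ s²)`). [cite: Omeara1963, §63B (63:10, 63:13a)] [cite: Kudla1997, §2] -/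
theorem hclass'_of_dead
    (S₁ : Finset (HeightOneSpectrum (𝓞 ↥(maximalRealSubfield L))))
    (val : Matrix (Fin n) (Fin n) L → ↥(maximalRealSubfield L))
    (hval : ∀ X : skewMatrices ((IsCMField.complexConj L : L ≃ₐ[Fp L] L) : L →+* L) ((gramR L e dV hdV dW hdW).map (algebraMap (Fp L) L)),
      (X : Matrix (Fin n) (Fin n) L) ≠ 0 → (X : Matrix (Fin n) (Fin n) L).det = 0 → val X ≠ 0)
    (Tf : ∀ X : skewMatrices ((IsCMField.complexConj L : L ≃ₐ[Fp L] L) : L →+* L) ((gramR L e dV hdV dW hdW).map (algebraMap (Fp L) L)),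
      ι X → HA L e dV hdV dW hdW → Finset (HeightOneSpectrum (𝓞 ↥(maximalRealSubfield L))))
    (σc : skewMatrices ((IsCMField.complexConj L : L ≃ₐ[Fp L] L) : L →+* L) ((gramR L e dV hdV dW hdW).map (algebraMap (Fp L) L)) →
      ∀ v : HeightOneSpectrum (𝓞 ↥(maximalRealSubfield L)), v.adicCompletion ↥(maximalRealSubfield L))
    (a : ∀ X : skewMatrices ((IsCMField.complexConj L : L ≃ₐ[Fp L] L) : L →+* L) ((gramR L e dV hdV dW hdW).map (algebraMap (Fp L) L)),
      ι X → HA L e dV hdV dW hdW → ∀ v : HeightOneSpectrum (𝓞 ↥(maximalRealSubfield L)), v.adicCompletion ↥(maximalRealSubfield L))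
    (ha : ∀ (X : skewMatrices ((IsCMField.complexConj L : L ≃ₐ[Fp L] L) : L →+* L) ((gramR L e dV hdV dW hdW).map (algebraMap (Fp L) L)))
      (j : ι X) (h : HA L e dV hdV dW hdW), ∀ v ∈ Tf X j h, a X j h v ≠ 0)
    -- (hfam) THE FAMILY INVARIANT: the class scalar detects the pattern `S₁` on the bad places
    (hfam : ∀ X : skewMatrices ((IsCMField.complexConj L : L ≃ₐ[Fp L] L) : L →+* L) ((gramR L e dV hdV dW hdW).map (algebraMap (Fp L) L)),
      (X : Matrix (Fin n) (Fin n) L) ≠ 0 → (X : Matrix (Fin n) (Fin n) L).det = 0 → ∀ (j : ι X) (h : HA L e dV hdV dW hdW), ∀ v ∈ Tf X j h,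
      (hilbertSymbol (v.adicCompletion ↥(maximalRealSubfield L)) (-(a X j h v))
          (algebraMap ↥(maximalRealSubfield L) (v.adicCompletion ↥(maximalRealSubfield L)) (cmQuadraticGenerator L : ↥(maximalRealSubfield L))) = -1 ↔
        v ∈ S₁))
    -- (hnorm) THE NORM CONGRUENCE: the local corner scalar is the constructor's value times a non-zero local norm `r² − θ s²`
    (hnorm : ∀ X : skewMatrices ((IsCMField.complexConj L : L ≃ₐ[Fp L] L) : L →+* L) ((gramR L e dV hdV dW hdW).map (algebraMap (Fp L) L)),
      (X : Matrix (Fin n) (Fin n) L) ≠ 0 → (X : Matrix (Fin n) (Fin n) L).det = 0 → ∀ (j : ι X) (h : HA L e dV hdV dW hdW), ∀ v ∈ Tf X j h,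
      ∃ r s : v.adicCompletion ↥(maximalRealSubfield L),
        r ^ 2 - algebraMap ↥(maximalRealSubfield L) (v.adicCompletion ↥(maximalRealSubfield L)) (cmQuadraticGenerator L : ↥(maximalRealSubfield L)) * s ^ 2 ≠ 0 ∧
        σc X v = algebraMap ↥(maximalRealSubfield L) (v.adicCompletion ↥(maximalRealSubfield L)) (val X) *
          (r ^ 2 - algebraMap ↥(maximalRealSubfield L) (v.adicCompletion ↥(maximalRealSubfield L)) (cmQuadraticGenerator L : ↥(maximalRealSubfield L)) * s ^ 2)) :
    ∀ X : skewMatrices ((IsCMField.complexConj L : L ≃ₐ[Fp L] L) : L →+* L) ((gramR L e dV hdV dW hdW).map (algebraMap (Fp L) L)),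
      (X : Matrix (Fin n) (Fin n) L) ≠ 0 → (X : Matrix (Fin n) (Fin n) L).det = 0 → ∀ (j : ι X) (h : HA L e dV hdV dW hdW), ∀ v ∈ Tf X j h,
      ¬ (hilbertSymbol (v.adicCompletion ↥(maximalRealSubfield L)) (algebraMap ↥(maximalRealSubfield L) _ (val X))
          (algebraMap ↥(maximalRealSubfield L) _ (cmQuadraticGenerator L : ↥(maximalRealSubfield L))) = -1 ↔ v ∈ S₁) →
      hilbertSymbol (v.adicCompletion ↥(maximalRealSubfield L)) (-(σc X v * (a X j h v)⁻¹))
        (algebraMap ↥(maximalRealSubfield L) (v.adicCompletion ↥(maximalRealSubfield L)) (cmQuadraticGenerator L : ↥(maximalRealSubfield L))) = -1 := by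
  intro X hX0 hdet j h v hv hdead
  obtain ⟨r, s, hN, hσ⟩ := hnorm X hX0 hdet j h v hv
  have hθ := K2LiuLocalSWSeamOfRecord.algebraMap_cmQuadraticGenerator_ne_zero L v
  have hx : algebraMap ↥(maximalRealSubfield L) (v.adicCompletion ↥(maximalRealSubfield L)) (val X) ≠ 0 := by
    rw [Ne, map_eq_zero_iff _ (algebraMap ↥(maximalRealSubfield L) (v.adicCompletion ↥(maximalRealSubfield L))).injective]
    exact hval X hX0 hdet
  exact K2LiuIncoherentRankOneBadPlaceLineModel.hilbertSymbol_eq_neg_one_of_dead ↥(maximalRealSubfield L) v hx (neg_ne_zero.2 (ha X j h v hv)) hθ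
    hdead (hfam X hX0 hdet j h v hv) hN (by rw [hσ, inv_neg]; ring)

/-- **(D-cls), LINE CURRENCY.**  The same `hclass′` from the complementary LINE's pattern letter (hline) `(a₁ X j h v, θ)_v = −1 ↔ v ∈ S₁` (`a₁ ≠ 0` on `Tf`), the norm
congruence (hnorm), and a square-class BRIDGE letter between the road's class scalar `a` and the line scalar `a₁`:
`hbridge : ∀ β ≠ 0, (−(β·(a X j h v)⁻¹), θ)_v = (β·(a₁ X j h v)⁻¹, θ)_v` on `Tf` — discharged at a non-split `v` by ★ p864360 §5 `hilbertSymbol_neg_mul_inv_det_eq`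
(`a = −(a₁·n)`, `n` a local norm: `−det(V₁ ⊕ H) ≡ a_{V₁}`).  Proof: ★ p863939 at `a₀ := a₁`, `u := σc·a₁⁻¹`, then the bridge at `β := σc X v`.
[cite: Omeara1963, §63B (63:10, 63:13a)] [cite: KudlaRallis1994, §2 (2.10)–(2.12)] -/
theorem hclass'_of_dead_of_line
    (S₁ : Finset (HeightOneSpectrum (𝓞 ↥(maximalRealSubfield L))))
    (val : Matrix (Fin n) (Fin n) L → ↥(maximalRealSubfield L))
    (hval : ∀ X : skewMatrices ((IsCMField.complexConj L : L ≃ₐ[Fp L] L) : L →+* L) ((gramR L e dV hdV dW hdW).map (algebraMap (Fp L) L)),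
      (X : Matrix (Fin n) (Fin n) L) ≠ 0 → (X : Matrix (Fin n) (Fin n) L).det = 0 → val X ≠ 0)
    (Tf : ∀ X : skewMatrices ((IsCMField.complexConj L : L ≃ₐ[Fp L] L) : L →+* L) ((gramR L e dV hdV dW hdW).map (algebraMap (Fp L) L)),
      ι X → HA L e dV hdV dW hdW → Finset (HeightOneSpectrum (𝓞 ↥(maximalRealSubfield L))))
    (σc : skewMatrices ((IsCMField.complexConj L : L ≃ₐ[Fp L] L) : L →+* L) ((gramR L e dV hdV dW hdW).map (algebraMap (Fp L) L)) →
      ∀ v : HeightOneSpectrum (𝓞 ↥(maximalRealSubfield L)), v.adicCompletion ↥(maximalRealSubfield L))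
    (hσ : ∀ X v, σc X v ≠ 0)
    (a a₁ : ∀ X : skewMatrices ((IsCMField.complexConj L : L ≃ₐ[Fp L] L) : L →+* L) ((gramR L e dV hdV dW hdW).map (algebraMap (Fp L) L)),
      ι X → HA L e dV hdV dW hdW → ∀ v : HeightOneSpectrum (𝓞 ↥(maximalRealSubfield L)), v.adicCompletion ↥(maximalRealSubfield L))
    (ha₁ : ∀ (X : skewMatrices ((IsCMField.complexConj L : L ≃ₐ[Fp L] L) : L →+* L) ((gramR L e dV hdV dW hdW).map (algebraMap (Fp L) L)))
      (j : ι X) (h : HA L e dV hdV dW hdW), ∀ v ∈ Tf X j h, a₁ X j h v ≠ 0)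
    -- (hline) THE LINE PATTERN: the complementary line's scalar detects `S₁`
    (hline : ∀ X : skewMatrices ((IsCMField.complexConj L : L ≃ₐ[Fp L] L) : L →+* L) ((gramR L e dV hdV dW hdW).map (algebraMap (Fp L) L)),
      (X : Matrix (Fin n) (Fin n) L) ≠ 0 → (X : Matrix (Fin n) (Fin n) L).det = 0 → ∀ (j : ι X) (h : HA L e dV hdV dW hdW), ∀ v ∈ Tf X j h,
      (hilbertSymbol (v.adicCompletion ↥(maximalRealSubfield L)) (a₁ X j h v)
          (algebraMap ↥(maximalRealSubfield L) (v.adicCompletion ↥(maximalRealSubfield L)) (cmQuadraticGenerator L : ↥(maximalRealSubfield L))) = -1 ↔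
        v ∈ S₁))
    -- (hbridge) THE SQUARE-CLASS BRIDGE `−a⁻¹ ≡ a₁⁻¹` (★ p864360 §5 at a non-split place)
    (hbridge : ∀ X : skewMatrices ((IsCMField.complexConj L : L ≃ₐ[Fp L] L) : L →+* L) ((gramR L e dV hdV dW hdW).map (algebraMap (Fp L) L)),
      (X : Matrix (Fin n) (Fin n) L) ≠ 0 → (X : Matrix (Fin n) (Fin n) L).det = 0 → ∀ (j : ι X) (h : HA L e dV hdV dW hdW), ∀ v ∈ Tf X j h,
      ∀ β : v.adicCompletion ↥(maximalRealSubfield L), β ≠ 0 →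
        hilbertSymbol (v.adicCompletion ↥(maximalRealSubfield L)) (-(β * (a X j h v)⁻¹))
            (algebraMap ↥(maximalRealSubfield L) (v.adicCompletion ↥(maximalRealSubfield L)) (cmQuadraticGenerator L : ↥(maximalRealSubfield L))) =
          hilbertSymbol (v.adicCompletion ↥(maximalRealSubfield L)) (β * (a₁ X j h v)⁻¹)
            (algebraMap ↥(maximalRealSubfield L) (v.adicCompletion ↥(maximalRealSubfield L)) (cmQuadraticGenerator L : ↥(maximalRealSubfield L))))
    -- (hnorm) THE NORM CONGRUENCE
    (hnorm : ∀ X : skewMatrices ((IsCMField.complexConj L : L ≃ₐ[Fp L] L) : L →+* L) ((gramR L e dV hdV dW hdW).map (algebraMap (Fp L) L)),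
      (X : Matrix (Fin n) (Fin n) L) ≠ 0 → (X : Matrix (Fin n) (Fin n) L).det = 0 → ∀ (j : ι X) (h : HA L e dV hdV dW hdW), ∀ v ∈ Tf X j h,
      ∃ r s : v.adicCompletion ↥(maximalRealSubfield L),
        r ^ 2 - algebraMap ↥(maximalRealSubfield L) (v.adicCompletion ↥(maximalRealSubfield L)) (cmQuadraticGenerator L : ↥(maximalRealSubfield L)) * s ^ 2 ≠ 0 ∧
        σc X v = algebraMap ↥(maximalRealSubfield L) (v.adicCompletion ↥(maximalRealSubfield L)) (val X) *
          (r ^ 2 - algebraMap ↥(maximalRealSubfield L) (v.adicCompletion ↥(maximalRealSubfield L)) (cmQuadraticGenerator L : ↥(maximalRealSubfield L)) * s ^ 2)) :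
    ∀ X : skewMatrices ((IsCMField.complexConj L : L ≃ₐ[Fp L] L) : L →+* L) ((gramR L e dV hdV dW hdW).map (algebraMap (Fp L) L)),
      (X : Matrix (Fin n) (Fin n) L) ≠ 0 → (X : Matrix (Fin n) (Fin n) L).det = 0 → ∀ (j : ι X) (h : HA L e dV hdV dW hdW), ∀ v ∈ Tf X j h,
      ¬ (hilbertSymbol (v.adicCompletion ↥(maximalRealSubfield L)) (algebraMap ↥(maximalRealSubfield L) _ (val X))
          (algebraMap ↥(maximalRealSubfield L) _ (cmQuadraticGenerator L : ↥(maximalRealSubfield L))) = -1 ↔ v ∈ S₁) →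
      hilbertSymbol (v.adicCompletion ↥(maximalRealSubfield L)) (-(σc X v * (a X j h v)⁻¹))
        (algebraMap ↥(maximalRealSubfield L) (v.adicCompletion ↥(maximalRealSubfield L)) (cmQuadraticGenerator L : ↥(maximalRealSubfield L))) = -1 := by
  intro X hX0 hdet j h v hv hdead
  obtain ⟨r, s, hN, hσ'⟩ := hnorm X hX0 hdet j h v hv
  have hθ := K2LiuLocalSWSeamOfRecord.algebraMap_cmQuadraticGenerator_ne_zero L v
  have hx : algebraMap ↥(maximalRealSubfield L) (v.adicCompletion ↥(maximalRealSubfield L)) (val X) ≠ 0 := by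
    rw [Ne, map_eq_zero_iff _ (algebraMap ↥(maximalRealSubfield L) (v.adicCompletion ↥(maximalRealSubfield L))).injective]
    exact hval X hX0 hdet
  rw [hbridge X hX0 hdet j h v hv (σc X v) (hσ X v)]
  exact K2LiuIncoherentRankOneBadPlaceLineModel.hilbertSymbol_eq_neg_one_of_dead ↥(maximalRealSubfield L) v hx (ha₁ X j h v hv) hθ
    hdead (hline X hX0 hdet j h v hv) hN (by rw [hσ']; ring)

end Summit.HodgeConjecture.HodgeConjecture.Cruxes.HLiu418.K2LiuIncoherentRankOneBadPlaceClassLetter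

end
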